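import Mathlib.Analysis.Calculus.MeanValue
import Mathlib.Analysis.SpecialFunctions.Pow.Deriv
import Mathlib.MeasureTheory.Integral.IntervalIntegral.FundThmCalculus
import HarnessLib

/-!
# Decay from Bernoulli-type differential inequalities:
# `f' ≤ −a f² + (α/t) f ⇒ f(t) ≤ (α+1)/(a t)` (Gallay–Šverák 2015) and
# `E' ≤ −κ t^m E^{1+γ} ⇒ E(t) ≤ ((m+1)/(κγ))^{1/γ} t^{−(m+1)/γ}` (the Nash iteration step, Feng–Šverák 2015)

Analysis/ODE proof file (theorems only; no definitions, no named facts). Two elementary real-variable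
lemmas, typed in the form in which they are PRINTED and used in

> Th. Gallay, V. Šverák, *Remarks on the Cauchy problem for the axisymmetric Navier–Stokes
> equations*, Confluentes Math. 7 (2015) 67–92 = arXiv:1510.01036, proof of Prop. 5.3 (p. 17):
> "`f'(t) ≤ −(K₁/M²) f(t)² + (K₂M/t) f(t)`, `0 < t ≤ T` (5.9) … If we set `f(t) = t^α g(t)` with
> `α = K₂M`, we see that (5.9) reduces to the simpler differential inequality
> `g'(t) ≤ −K₁M⁻² t^α g(t)²`, which can be integrated … We conclude that
> `‖ω_θ(t)‖²_{L²(Ω)} = f(t) = t^α g(t) ≤ ((α+1)/K₁)(M²/t) = ((K₂M+1)/K₁)(M²/t)`",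

> H. Feng, V. Šverák, *On the Cauchy problem for axi-symmetric vortex rings*, Arch. Ration. Mech.
> Anal. 215 (2015) 89–123 = arXiv:1301.6317, proof of Lemma 3.8 (arXiv p. 12), the Nash iteration:
> "`(3/2)[(E_p)^{−2/3}]_t = −(dE_p/dt)/(E_p)^{5/3} ≥ (4(p−1)/p) M C_q^{−2p/3} t^{p−2}` ⟹ …
> ⟹ `‖η(t)‖_{L^p} = E_p(t)^{1/p} ≤ (3p/(8M))^{3/(2p)} C_q t^{−(3/2)(1−1/p)}`",

— the two ODE steps of the printed proof of Gallay–Šverák's a-priori estimate (1.11) (tree: the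
named fact `Literature.Analysis.FluidPDE.GallaySverak2015.VorticitySupBound`, not imported here).

## Contents (all proved)

* `le_div_of_deriv_le_neg_mul_sq_add_div_mul` — `f` continuous on `[0, T]`, differentiable on
  `(0, T)` with `f' ≤ −a f² + (α/t) f` (`a > 0`, `α ≥ 0`) ⟹ `f(t) ≤ (α+1)/(a t)` on `(0, T]`;
  `GallaySverak2015.le_of_diffIneq` — the same with the paper's constants
  (`a = K₁/M²`, `α = K₂M`: `f(t) ≤ ((K₂M+1)/K₁) M²/t`);
* `le_mul_rpow_of_deriv_le_neg_mul_rpow_mul_rpow` — `E` continuous on `[0, T]`, differentiable on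
  `(0, T)` with `E' ≤ −κ t^m E^{1+γ}` (`κ > 0`, `m > −1`, `γ > 0`) ⟹
  `E(t) ≤ ((m+1)/(κγ))^{1/γ} t^{−(m+1)/γ}` on `(0, T]` (Feng–Šverák: `γ = 2/3`, `m = p − 2`,
  `κ = (4(p−1)/p) M C_q^{−2p/3}`, giving their `(3p/(8M))^{3/2} C_q^p t^{−3(p−1)/2}`);
  `le_mul_rpow_of_le_sub_intervalIntegral` — the same conclusion from the INTEGRATED inequality
  `E(t) ≤ E(s) − ∫ₛᵗ κ τ^m E^{1+γ} dτ` (`0 < s ≤ t ≤ T`, `m ≥ 0`), `E` merely continuous — the form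
  produced by energy balances with a.e. time derivatives (no `HasDerivAt` needed);
* `le_mul_rpow_of_sub_eq_integral_of_slice_le` — BOTH mechanisms at once, integrated form:
  `F(t) − F(s) = ∫ₛᵗ σ` with `σ ≤ −a τ^m F^{1+γ} + (α/τ) F` (`a > 0`, `m ≥ 0`, `γ > 0`, `α ≥ 0`)
  ⟹ `F(t) ≤ ((m+1+αγ)/(aγ))^{1/γ} t^{−(m+1)/γ}` on `(0, T]` (the exact solution of
  `Y' = −a t^m Y^{1+γ} + (α/t) Y` through `+∞` at `0⁺`; for `γ = 1`, `m = 0` this is Gallay–Šverák's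
  `(α+1)/(a t)`), the step of a Nash iteration carrying Gallay–Šverák's potential term `(K₂M/t) f`.

## The proofs (by fencing, not by the printed quadrature)

Both bounds are EXACT solutions of the corresponding differential EQUATIONS blowing up at
`t = 0⁺`: `B(t) = (α+1)/(a t)` solves `B' = −aB² + (α/t)B`, and `Y(t) = λ t^{−(m+1)/γ}` with
`λ^γ = (m+1)/(κγ)` solves `Y' = −κ t^m Y^{1+γ}`. Slightly larger constants (`α+1+ε`, `λ_ε > λ`)
make them STRICT supersolutions; since `f` is bounded on `[0, T]` while the barrier tends to `+∞`
at `0⁺`, `f(t₀) ≤ B_ε(t₀)` for small `t₀`, and Mathlib's fencing theorem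
`image_le_of_deriv_right_lt_deriv_boundary'` gives `f ≤ B_ε` on `[t₀, T]`; finally `ε → 0`
(`le_of_forall_pos_le_add`). This avoids dividing by `f` (the printed integration of `(1/g)'` and
`(E^{−2/3})'` tacitly uses `f, E > 0`) and needs no sign condition. For the integrated form the
exact solution `Y` itself is compared with `E` on the last interval `[t₀, t₁]` where `E ≥ Y`
(`t₀ = sup{s : E(s) ≤ Y(s)}`, `IsClosed.csSup_mem`), using the monotonicity of
`∫ κτ^m (·)^{1+γ}` and the fundamental theorem of calculus for `Y`.

## Mathlib / tree search

`lean search 'riccati|Bernoulli.*inequal|deriv_le_neg_mul_sq|Nash iteration'` (2026-08-27): the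
tree's `Literature/Analysis/ODE/LinearComparison.lean` has the LINEAR (Grönwall) comparison
`g' ≤ A + βg`; `ChenHou2024HolderBlowupInstability.riccatiFlow` is the explicit flow of `u' = u²`;
no decay lemma for `f' ≤ −af² + (α/t)f` or `E' ≤ −κt^m E^{1+γ}`. Mathlib (used):
`image_le_of_deriv_right_lt_deriv_boundary'`, `IsCompact.bddAbove_image`, `hasDerivAt_inv`,
`Real.hasDerivAt_rpow_const`, `Real.continuousAt_rpow_const`, `Real.rpow_inv_rpow`,
`Real.rpow_le_rpow_of_nonpos`, `Real.rpow_lt_rpow`, `Real.mul_rpow`, `Real.rpow_mul`,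
`Real.rpow_add`, `le_of_forall_pos_le_add`, `IsClosed.csSup_mem`,
`ContinuousOn.preimage_isClosed_of_isClosed`, `intervalIntegral.integral_mono_on_of_le_Ioo`,
`intervalIntegral.integral_eq_sub_of_hasDerivAt`.

## References

* Th. Gallay, V. Šverák, *Remarks on the Cauchy problem for the axisymmetric Navier–Stokes
  equations*, Confluentes Math. 7 (2015) 67–92 = arXiv:1510.01036, proof of Prop. 5.3, (5.9),
  p. 17. [GallaySverak2016]
* H. Feng, V. Šverák, *On the Cauchy problem for axi-symmetric vortex rings*, Arch. Ration. Mech.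
  Anal. 215 (2015) 89–123 = arXiv:1301.6317, Lemma 3.8 and its proof (arXiv p. 12), after
  J. Nash, Amer. J. Math. 80 (1958) 931–954. [FengSverak2015]
-/

noncomputable section

open Set Filter Topology MeasureTheory

namespace Literature.Analysis.ODE

/-! ### Comparison with a barrier that blows up at `t = 0⁺` -/

/-- **Fencing from `0⁺`.** Let `f` be continuous on `[0, T]` with derivative `f'` on `(0, T)`, and
let the barrier `B` be continuous on `(0, T]` with derivative `B'` on `(0, T)`, blowing up at `0⁺`
(`B(s) ≥ K` on `(0, δ_K)` for every `K`), with the touching condition `f(s) = B(s) ⇒ f'(s) < B'(s)`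
on `(0, T)`. Then `f ≤ B` on `(0, T]`: `f` is bounded on `[0, T]`, so `f(t₀) ≤ B(t₀)` for `t₀`
small, and Mathlib's fencing theorem `image_le_of_deriv_right_lt_deriv_boundary'` applies on
`[t₀, T]`. [folklore] -/
private theorem le_barrier_of_touching_of_blowup {f f' B B' : ℝ → ℝ} {T : ℝ}
    (hf : ContinuousOn f (Icc 0 T)) (hf' : ∀ s ∈ Ioo 0 T, HasDerivAt f (f' s) s)
    (hB : ∀ s ∈ Ioc 0 T, ContinuousAt B s) (hB' : ∀ s ∈ Ioo 0 T, HasDerivAt B (B' s) s)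
    (hblow : ∀ K : ℝ, ∃ δ > 0, ∀ s ∈ Ioo 0 δ, K ≤ B s)
    (htouch : ∀ s ∈ Ioo 0 T, f s = B s → f' s < B' s) :
    ∀ t ∈ Ioc 0 T, f t ≤ B t := by
  intro t ht
  obtain ⟨K, hK⟩ : ∃ K, ∀ s ∈ Icc 0 T, f s ≤ K := by
    obtain ⟨K, hK⟩ := isCompact_Icc.bddAbove_image hf
    exact ⟨K, fun s hs => hK (mem_image_of_mem f hs)⟩
  obtain ⟨δ, hδ, hKB⟩ := hblow K
  set t₀ : ℝ := min t (δ / 2) with ht₀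
  have ht₀pos : 0 < t₀ := lt_min ht.1 (by linarith)
  have ht₀t : t₀ ≤ t := min_le_left _ _
  have ht₀δ : t₀ < δ := (min_le_right _ _).trans_lt (by linarith)
  have ht₀T : t₀ ≤ T := ht₀t.trans ht.2
  have h0 : f t₀ ≤ B t₀ := (hK t₀ ⟨ht₀pos.le, ht₀T⟩).trans (hKB t₀ ⟨ht₀pos, ht₀δ⟩)
  have hfc : ContinuousOn f (Icc t₀ T) := hf.mono (Icc_subset_Icc ht₀pos.le le_rfl)
  have hBc : ContinuousOn B (Icc t₀ T) := fun s hs =>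
    (hB s ⟨ht₀pos.trans_le hs.1, hs.2⟩).continuousWithinAt
  have hfd : ∀ s ∈ Ico t₀ T, HasDerivWithinAt f (f' s) (Ici s) s := fun s hs =>
    (hf' s ⟨ht₀pos.trans_le hs.1, hs.2⟩).hasDerivWithinAt
  have hBd : ∀ s ∈ Ico t₀ T, HasDerivWithinAt B (B' s) (Ici s) s := fun s hs =>
    (hB' s ⟨ht₀pos.trans_le hs.1, hs.2⟩).hasDerivWithinAt
  have hbound : ∀ s ∈ Ico t₀ T, f s = B s → f' s < B' s := fun s hs =>
    htouch s ⟨ht₀pos.trans_le hs.1, hs.2⟩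
  exact image_le_of_deriv_right_lt_deriv_boundary' hfc hfd h0 hBc hBd hbound ⟨ht₀t, ht.2⟩

/-- A barrier `c/s` with `c > 0` blows up at `0⁺`. [folklore] -/
private theorem blowup_const_div {c : ℝ} (hc : 0 < c) (K : ℝ) :
    ∃ δ > 0, ∀ s ∈ Ioo 0 δ, K ≤ c * s⁻¹ := by
  refine ⟨c / max K 1, div_pos hc (lt_max_of_lt_right one_pos), fun s hs => ?_⟩
  have hm : 0 < max K 1 := lt_max_of_lt_right one_pos
  have h1 : K ≤ max K 1 := le_max_left _ _
  have h2 : max K 1 ≤ c * s⁻¹ := by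
    rw [← div_eq_mul_inv, le_div_iff₀ hs.1]
    calc max K 1 * s ≤ max K 1 * (c / max K 1) :=
          mul_le_mul_of_nonneg_left hs.2.le hm.le
      _ = c := by field_simp
  exact h1.trans h2

/-! ### `f' ≤ −a f² + (α/t) f` -/

/-- **Gallay–Šverák's differential inequality.** Let `f : [0, T] → ℝ` be continuous, differentiable
on `(0, T)`, with `f'(t) ≤ −a f(t)² + (α/t) f(t)` for `0 < t < T`, where `a > 0`, `α ≥ 0`. Then
`f(t) ≤ (α + 1)/(a t)` for all `0 < t ≤ T` (Gallay–Šverák, proof of Prop. 5.3: "If we set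
`f(t) = t^α g(t)` with `α = K₂M`, we see that (5.9) reduces to the simpler differential inequality
`g'(t) ≤ −K₁M⁻²t^α g(t)²`, which can be integrated over the time interval `[t₀, t] ⊂ (0, T]` … We
conclude that `f(t) = t^α g(t) ≤ ((α+1)/K₁)(M²/t)`"). Proof here: for every `ε > 0` the function
`B_ε(t) = (α+1+ε)/(a t)` is a strict supersolution (`−aB_ε² + (α/t)B_ε = −(1+ε)B_ε/t < −B_ε/t = B_ε'`)
blowing up at `0⁺`, so `f ≤ B_ε` on `(0, T]` by fencing from `0⁺`; let `ε → 0`. No sign condition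
on `f` is needed. [cite: GallaySverak2016, proof of Prop. 5.3, (5.9) and the display after it (arXiv p. 17)] -/
theorem le_div_of_deriv_le_neg_mul_sq_add_div_mul {f f' : ℝ → ℝ} {T a α : ℝ} (ha : 0 < a)
    (hα : 0 ≤ α) (hf : ContinuousOn f (Icc 0 T)) (hf' : ∀ t ∈ Ioo 0 T, HasDerivAt f (f' t) t)
    (hode : ∀ t ∈ Ioo 0 T, f' t ≤ -a * f t ^ 2 + α / t * f t) :
    ∀ t ∈ Ioc 0 T, f t ≤ (α + 1) / (a * t) := by
  intro t ht
  refine le_of_forall_pos_le_add fun ε' hε' => ?_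
  -- the barrier `B(s) = (c/a) s⁻¹`, `c = α + 1 + ε`, `ε = ε' a t`
  set ε : ℝ := ε' * (a * t) with hε
  have hεpos : 0 < ε := by rw [hε]; exact mul_pos hε' (mul_pos ha ht.1)
  set c : ℝ := α + 1 + ε with hc
  have hcpos : 0 < c := by rw [hc]; linarith
  have hca : 0 < c / a := div_pos hcpos ha
  have key : ∀ s ∈ Ioc 0 T, f s ≤ c / a * s⁻¹ := by
    refine le_barrier_of_touching_of_blowup (B' := fun s => c / a * (-(s ^ 2)⁻¹)) hf hf'
      (fun s hs => ?_) (fun s hs => ?_) (blowup_const_div hca) (fun s hs hfs => ?_)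
    · exact continuousAt_const.mul (continuousAt_inv₀ hs.1.ne')
    · exact (hasDerivAt_inv hs.1.ne').const_mul (c / a)
    · -- touching: `f' ≤ −aB² + (α/s)B = −(1+ε)(c/a)s⁻² < −(c/a)s⁻² = B'`
      have hs0 : 0 < s := hs.1
      refine (hode s hs).trans_lt ?_
      rw [hfs]
      have hpos : 0 < c / a * (s ^ 2)⁻¹ := mul_pos hca (inv_pos.2 (pow_pos hs0 2))
      have e1 : -a * (c / a * s⁻¹) ^ 2 + α / s * (c / a * s⁻¹) =
          c / a * (s ^ 2)⁻¹ * (-(1 + ε)) := by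
        rw [hc]
        field_simp
        ring
      have e2 : c / a * (-(s ^ 2)⁻¹) = c / a * (s ^ 2)⁻¹ * (-1) := by ring
      rw [e1, e2]
      exact mul_lt_mul_of_pos_left (by linarith) hpos
  have h := key t ht
  have ht0 : t ≠ 0 := ht.1.ne'
  have e3 : c / a * t⁻¹ = (α + 1) / (a * t) + ε' := by
    rw [hc, hε]
    field_simp
  linarith [h, e3]

/-- **Gallay–Šverák's differential inequality, with the paper's constants**: if
`f'(t) ≤ −(K₁/M²) f(t)² + (K₂M/t) f(t)` on `(0, T)` (`K₁, M > 0`, `K₂ ≥ 0`) for `f` continuous on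
`[0, T]`, then `f(t) ≤ ((K₂M + 1)/K₁) · M²/t` for `0 < t ≤ T` — in the paper `f(t) = ‖ω_θ(t)‖²_{L²(Ω)}`,
`M = ‖ω₀‖_{L¹(Ω)}`, giving (5.7) for `p = 2`. [cite: GallaySverak2016, proof of Prop. 5.3, (5.9) ff. (arXiv p. 17)] -/
theorem GallaySverak2015.le_of_diffIneq {f f' : ℝ → ℝ} {T K₁ K₂ M : ℝ} (hK₁ : 0 < K₁)
    (hK₂ : 0 ≤ K₂) (hM : 0 < M) (hf : ContinuousOn f (Icc 0 T))
    (hf' : ∀ t ∈ Ioo 0 T, HasDerivAt f (f' t) t)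
    (hode : ∀ t ∈ Ioo 0 T, f' t ≤ -(K₁ / M ^ 2) * f t ^ 2 + K₂ * M / t * f t) :
    ∀ t ∈ Ioc 0 T, f t ≤ (K₂ * M + 1) / K₁ * (M ^ 2 / t) := by
  intro t ht
  have h := le_div_of_deriv_le_neg_mul_sq_add_div_mul (a := K₁ / M ^ 2) (α := K₂ * M)
    (div_pos hK₁ (pow_pos hM 2)) (mul_nonneg hK₂ hM.le) hf hf' hode t ht
  refine h.trans (le_of_eq ?_)
  field_simp

/-! ### `E' ≤ −κ t^m E^{1+γ}`: the Nash iteration step -/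

/-- **The Nash-iteration differential inequality (Feng–Šverák).** Let `E : [0, T] → ℝ` be
continuous, differentiable on `(0, T)`, with `E'(t) ≤ −κ t^m E(t)^{1+γ}` for `0 < t < T`
(`κ > 0`, `m > −1`, `γ > 0`, real powers `Real.rpow`; in the application `E ≥ 0`, which is not
needed for the conclusion). Then
`E(t) ≤ ((m+1)/(κγ))^{1/γ} · t^{−(m+1)/γ}` for `0 < t ≤ T`. This is the step of Nash's method as
printed by Feng–Šverák, proof of Lemma 3.8 (with `γ = 2/3`, `m = p − 2`,
`κ = (4(p−1)/p) M C_q^{−2p/3}`: "`(3/2)[(E_p)^{−2/3}]_t ≥ (4(p−1)/p) M C_q^{−2p/3} t^{p−2}` ⟹ …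
⟹ `‖η(t)‖_{L^p} = E_p(t)^{1/p} ≤ (3p/(8M))^{3/(2p)} C_q t^{−(3/2)(1−1/p)}`"; indeed
`((p−1)/(κ · 2/3))^{3/2} = (3p/(8M))^{3/2} C_q^p`). Proof here: for `λ_ε > λ = ((m+1)/(κγ))^{1/γ}`
the function `λ_ε t^{−(m+1)/γ}` is a strict supersolution blowing up at `0⁺`; fence from `0⁺`
and let `λ_ε → λ`. The printed argument integrates `(E^{−γ})' ≥ κγ t^m` instead (and needs
`E > 0`); the conclusion is the same. [cite: FengSverak2015, proof of Lemma 3.8 (arXiv:1301.6317, p. 12)] -/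
theorem le_mul_rpow_of_deriv_le_neg_mul_rpow_mul_rpow {E E' : ℝ → ℝ} {T κ m γ : ℝ} (hκ : 0 < κ)
    (hm : -1 < m) (hγ : 0 < γ) (hE : ContinuousOn E (Icc 0 T))
    (hE' : ∀ t ∈ Ioo 0 T, HasDerivAt E (E' t) t)
    (hode : ∀ t ∈ Ioo 0 T, E' t ≤ -κ * t ^ m * E t ^ (1 + γ)) :
    ∀ t ∈ Ioc 0 T, E t ≤ ((m + 1) / (κ * γ)) ^ (1 / γ) * t ^ (-(m + 1) / γ) := by
  intro t ht
  set q : ℝ := -(m + 1) / γ with hq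
  set Λ : ℝ := ((m + 1) / (κ * γ)) ^ (1 / γ) with hΛ
  have hm1 : 0 < m + 1 := by linarith
  have hbase : 0 < (m + 1) / (κ * γ) := div_pos hm1 (mul_pos hκ hγ)
  have hΛpos : 0 < Λ := Real.rpow_pos_of_pos hbase _
  have hΛγ : Λ ^ γ = (m + 1) / (κ * γ) := by
    rw [hΛ, one_div, Real.rpow_inv_rpow hbase.le hγ.ne']
  have hqγ : q * γ = -(m + 1) := by rw [hq]; field_simp
  have hqneg : q < 0 := by rw [hq]; exact div_neg_of_neg_of_pos (by linarith) hγ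
  have htq : 0 < t ^ q := Real.rpow_pos_of_pos ht.1 q
  refine le_of_forall_pos_le_add fun ε' hε' => ?_
  -- the barrier `B(s) = Λε s^q` with `Λε t^q = Λ t^q + ε'`
  set Λε : ℝ := Λ + ε' * (t ^ q)⁻¹ with hΛε
  have hΛΛε : Λ < Λε := by rw [hΛε]; exact lt_add_of_pos_right _ (mul_pos hε' (inv_pos.2 htq))
  have hΛεpos : 0 < Λε := hΛpos.trans hΛΛε
  have hΛεγ : (m + 1) / (κ * γ) < Λε ^ γ := by
    rw [← hΛγ]; exact Real.rpow_lt_rpow hΛpos.le hΛΛε hγ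
  have key : ∀ s ∈ Ioc 0 T, E s ≤ Λε * s ^ q := by
    refine le_barrier_of_touching_of_blowup (B' := fun s => Λε * (q * s ^ (q - 1))) hE hE'
      (fun s hs => ?_) (fun s hs => ?_) (fun K => ?_) (fun s hs hEs => ?_)
    · exact continuousAt_const.mul (Real.continuousAt_rpow_const s q (Or.inl hs.1.ne'))
    · exact (Real.hasDerivAt_rpow_const (Or.inl hs.1.ne')).const_mul Λε
    · -- blow-up at `0⁺`: `s ≤ δ ⇒ s^q ≥ δ^q = max K 1 / Λε`
      have hK1 : 0 < max K 1 := lt_max_of_lt_right one_pos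
      set δ : ℝ := (max K 1 / Λε) ^ q⁻¹ with hδ
      have hδpos : 0 < δ := Real.rpow_pos_of_pos (div_pos hK1 hΛεpos) _
      have hδq : δ ^ q = max K 1 / Λε := by
        rw [hδ, Real.rpow_inv_rpow (div_pos hK1 hΛεpos).le hqneg.ne]
      refine ⟨δ, hδpos, fun s hs => (le_max_left K 1).trans ?_⟩
      have h1 : δ ^ q ≤ s ^ q := Real.rpow_le_rpow_of_nonpos hs.1 hs.2.le hqneg.le
      rw [hδq, div_le_iff₀ hΛεpos] at h1
      linarith [h1]
    · -- touching: `E' ≤ −κ s^m (Λε s^q)^{1+γ} = −κ Λε^γ · Λε s^{q−1} < q · Λε s^{q−1} = B'`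
      have hs0 : 0 < s := hs.1
      refine (hode s hs).trans_lt ?_
      rw [hEs]
      have hs := hs0
      have e1 : (Λε * s ^ q) ^ (1 + γ) = Λε * Λε ^ γ * s ^ (q * (1 + γ)) := by
        rw [Real.mul_rpow hΛεpos.le (Real.rpow_nonneg hs.le _), ← Real.rpow_mul hs.le,
          Real.rpow_add hΛεpos, Real.rpow_one]
      have e2 : s ^ m * s ^ (q * (1 + γ)) = s ^ (q - 1) := by
        rw [← Real.rpow_add hs]
        congr 1
        linear_combination hqγ
      have e3 : -κ * s ^ m * (Λε * Λε ^ γ * s ^ (q * (1 + γ))) =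
          Λε * s ^ (q - 1) * (-(κ * Λε ^ γ)) := by
        rw [← e2]; ring
      have e4 : Λε * (q * s ^ (q - 1)) = Λε * s ^ (q - 1) * q := by ring
      rw [e1, e3, e4]
      have hpos : 0 < Λε * s ^ (q - 1) := mul_pos hΛεpos (Real.rpow_pos_of_pos hs _)
      refine mul_lt_mul_of_pos_left ?_ hpos
      -- `−κ Λε^γ < q ⟺ (m+1)/γ < κ Λε^γ`
      have h1 : (m + 1) / γ < κ * Λε ^ γ := by
        have h3 := mul_lt_mul_of_pos_left hΛεγ hκ
        have e6 : κ * ((m + 1) / (κ * γ)) = (m + 1) / γ := by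
          field_simp
        rwa [e6] at h3
      have h2 : q = -((m + 1) / γ) := by rw [hq, neg_div]
      rw [h2]
      linarith
  have h := key t ht
  have e5 : Λε * t ^ q = Λ * t ^ q + ε' := by
    rw [hΛε, add_mul, mul_assoc, inv_mul_cancel₀ htq.ne', mul_one]
  linarith [h, e5]

/-! ### The integrated form of the Nash-iteration step -/

/-- **The Nash-iteration step, integrated form** (no differentiability of `E`): let `E` be
continuous on `[0, T]` (in the application `E ≥ 0`, not needed) and satisfy the integrated inequality
`E(t) ≤ E(s) − ∫ₛᵗ κ τ^m E(τ)^{1+γ} dτ` for all `0 < s ≤ t ≤ T` (`κ > 0`, `m ≥ 0`, `γ > 0`) — the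
form delivered by energy balances stated through a.e. time derivatives. Then again
`E(t) ≤ ((m+1)/(κγ))^{1/γ} t^{−(m+1)/γ}` on `(0, T]`. Proof: with the exact solution
`Y = λ t^{−(m+1)/γ}`, `λ^γ = (m+1)/(κγ)` (`Y' = −κ t^m Y^{1+γ}`), suppose `E(t₁) > Y(t₁)`; since `E`
is bounded and `Y(0⁺) = +∞` there is a last time `t₀ < t₁` with `E(t₀) ≤ Y(t₀)`, and on
`(t₀, t₁]`, where `E > Y ≥ 0`,
`E(t₁) ≤ E(t₀) − ∫_{t₀}^{t₁} κτ^m E^{1+γ} ≤ Y(t₀) − ∫_{t₀}^{t₁} κτ^m Y^{1+γ} = Y(t₁)`, a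
contradiction (Feng–Šverák's step "integrate `(3/2)[(E_p)^{−2/3}]_t ≥ …`", arXiv p. 12, here without
dividing by `E`). [cite: FengSverak2015, proof of Lemma 3.8 (arXiv:1301.6317, p. 12)] -/
theorem le_mul_rpow_of_le_sub_intervalIntegral {E : ℝ → ℝ} {T κ m γ : ℝ} (hκ : 0 < κ)
    (hm : 0 ≤ m) (hγ : 0 < γ) (hE : ContinuousOn E (Icc 0 T))
    (hineq : ∀ s t, 0 < s → s ≤ t → t ≤ T →
      E t ≤ E s - ∫ τ in s..t, κ * τ ^ m * E τ ^ (1 + γ)) :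
    ∀ t ∈ Ioc 0 T, E t ≤ ((m + 1) / (κ * γ)) ^ (1 / γ) * t ^ (-(m + 1) / γ) := by
  intro t₁ ht₁
  set q : ℝ := -(m + 1) / γ with hq
  set Λ : ℝ := ((m + 1) / (κ * γ)) ^ (1 / γ) with hΛ
  have hm1 : 0 < m + 1 := by linarith
  have hbase : 0 < (m + 1) / (κ * γ) := div_pos hm1 (mul_pos hκ hγ)
  have hΛpos : 0 < Λ := Real.rpow_pos_of_pos hbase _
  have hΛγ : Λ ^ γ = (m + 1) / (κ * γ) := by
    rw [hΛ, one_div, Real.rpow_inv_rpow hbase.le hγ.ne']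
  have hqγ : q * γ = -(m + 1) := by rw [hq]; field_simp
  have hqneg : q < 0 := by rw [hq]; exact div_neg_of_neg_of_pos (by linarith) hγ
  have hγ1 : (0 : ℝ) ≤ 1 + γ := by linarith
  -- the exact solution `Y = Λ s^q`, `Y' = −κ s^m Y^{1+γ}` on `(0, ∞)`
  set Y : ℝ → ℝ := fun s => Λ * s ^ q with hY
  have hYpos : ∀ {s : ℝ}, 0 < s → 0 < Y s := fun hs => mul_pos hΛpos (Real.rpow_pos_of_pos hs _)
  have hYder : ∀ {s : ℝ}, 0 < s → HasDerivAt Y (-κ * s ^ m * Y s ^ (1 + γ)) s := by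
    intro s hs
    have h := (Real.hasDerivAt_rpow_const (p := q) (Or.inl hs.ne')).const_mul Λ
    have e1 : (Λ * s ^ q) ^ (1 + γ) = Λ * Λ ^ γ * s ^ (q * (1 + γ)) := by
      rw [Real.mul_rpow hΛpos.le (Real.rpow_nonneg hs.le _), ← Real.rpow_mul hs.le,
        Real.rpow_add hΛpos, Real.rpow_one]
    have e2 : s ^ m * s ^ (q * (1 + γ)) = s ^ (q - 1) := by
      rw [← Real.rpow_add hs]
      congr 1
      linear_combination hqγ
    have hq' : q = -(κ * ((m + 1) / (κ * γ))) := by rw [hq]; field_simp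
    have e3 : -κ * s ^ m * Y s ^ (1 + γ) = Λ * (q * s ^ (q - 1)) := by
      show -κ * s ^ m * (Λ * s ^ q) ^ (1 + γ) = Λ * (q * s ^ (q - 1))
      rw [e1, show -κ * s ^ m * (Λ * Λ ^ γ * s ^ (q * (1 + γ))) =
        -(κ * Λ ^ γ) * Λ * (s ^ m * s ^ (q * (1 + γ))) by ring, e2, hΛγ, hq']
      ring
    rw [e3]
    exact h
  by_contra hcon
  have hcon' : Y t₁ < E t₁ := by
    have := not_le.1 hcon
    simpa only [hY] using this
  -- `E` is bounded on `[0, T]`; a small `δ ≤ t₁` with `E δ ≤ Y δ`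
  obtain ⟨K, hK⟩ : ∃ K, ∀ s ∈ Icc 0 T, E s ≤ K := by
    obtain ⟨K, hK⟩ := isCompact_Icc.bddAbove_image hE
    exact ⟨K, fun s hs => hK (mem_image_of_mem E hs)⟩
  have hK1 : 0 < max K 1 := lt_max_of_lt_right one_pos
  set δ₀ : ℝ := (max K 1 / Λ) ^ q⁻¹ with hδ₀
  have hδ₀pos : 0 < δ₀ := Real.rpow_pos_of_pos (div_pos hK1 hΛpos) _
  have hδ₀q : δ₀ ^ q = max K 1 / Λ := by
    rw [hδ₀, Real.rpow_inv_rpow (div_pos hK1 hΛpos).le hqneg.ne]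
  set δ : ℝ := min δ₀ t₁ with hδ
  have hδpos : 0 < δ := lt_min hδ₀pos ht₁.1
  have hδt : δ ≤ t₁ := min_le_right _ _
  have hδT : δ ≤ T := hδt.trans ht₁.2
  have hEδ : E δ ≤ Y δ := by
    have h1 : δ₀ ^ q ≤ δ ^ q := Real.rpow_le_rpow_of_nonpos hδpos (min_le_left _ _) hqneg.le
    rw [hδ₀q, div_le_iff₀ hΛpos] at h1
    calc E δ ≤ K := hK δ ⟨hδpos.le, hδT⟩
      _ ≤ max K 1 := le_max_left _ _
      _ ≤ δ ^ q * Λ := h1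
      _ = Y δ := by simp only [hY]; ring
  -- the last time `t₀ ∈ [δ, t₁]` at which `E ≤ Y`
  set A : Set ℝ := Icc δ t₁ ∩ (fun s => E s - Y s) ⁻¹' Iic 0 with hA
  have hYc : ContinuousOn Y (Icc δ t₁) := fun s hs =>
    (continuousAt_const.mul
      (Real.continuousAt_rpow_const s q (Or.inl (hδpos.trans_le hs.1).ne'))).continuousWithinAt
  have hEc : ContinuousOn E (Icc δ t₁) := hE.mono (Icc_subset_Icc hδpos.le ht₁.2)
  have hAc : IsClosed A := (hEc.sub hYc).preimage_isClosed_of_isClosed isClosed_Icc isClosed_Iic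
  have hδA : δ ∈ A := ⟨⟨le_rfl, hδt⟩, show E δ - Y δ ≤ 0 by linarith⟩
  have hAbdd : BddAbove A := ⟨t₁, fun s hs => hs.1.2⟩
  set t₀ : ℝ := sSup A with ht₀
  have ht₀A : t₀ ∈ A := hAc.csSup_mem ⟨δ, hδA⟩ hAbdd
  have ht₀δ : δ ≤ t₀ := ht₀A.1.1
  have ht₀pos : 0 < t₀ := hδpos.trans_le ht₀δ
  have ht₀t₁ : t₀ ≤ t₁ := ht₀A.1.2
  have hEt₀ : E t₀ ≤ Y t₀ := by
    have h : E t₀ - Y t₀ ≤ 0 := ht₀A.2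
    linarith
  have ht₀lt : t₀ < t₁ := by
    rcases ht₀t₁.eq_or_lt with h | h
    · rw [h] at hEt₀; exact absurd hEt₀ (not_le.2 hcon')
    · exact h
  have habove : ∀ τ ∈ Ioo t₀ t₁, Y τ ≤ E τ := by
    intro τ hτ
    by_contra hlt
    have hτA : τ ∈ A := ⟨⟨ht₀δ.trans hτ.1.le, hτ.2.le⟩, show E τ - Y τ ≤ 0 by
      linarith [not_le.1 hlt]⟩
    exact absurd (le_csSup hAbdd hτA) (not_le.2 hτ.1)
  -- integrability on `[t₀, t₁]`
  have hpos_of_mem : ∀ τ ∈ uIcc t₀ t₁, 0 < τ := fun τ hτ => by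
    rw [uIcc_of_le ht₀t₁] at hτ; exact ht₀pos.trans_le hτ.1
  have hcm : ContinuousOn (fun τ : ℝ => κ * τ ^ m) (uIcc t₀ t₁) := fun τ _ =>
    (continuousAt_const.mul (Real.continuousAt_rpow_const τ m (Or.inr hm))).continuousWithinAt
  have hiE : IntervalIntegrable (fun τ => κ * τ ^ m * E τ ^ (1 + γ)) volume t₀ t₁ := by
    refine ContinuousOn.intervalIntegrable (hcm.mul ?_)
    rw [uIcc_of_le ht₀t₁]
    exact ((Real.continuous_rpow_const hγ1).comp_continuousOn
      (hE.mono (Icc_subset_Icc ht₀pos.le ht₁.2)))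
  have hiY : IntervalIntegrable (fun τ => κ * τ ^ m * Y τ ^ (1 + γ)) volume t₀ t₁ := by
    refine ContinuousOn.intervalIntegrable (hcm.mul ?_)
    rw [uIcc_of_le ht₀t₁]
    exact (Real.continuous_rpow_const hγ1).comp_continuousOn
      (hYc.mono (Icc_subset_Icc ht₀δ le_rfl))
  -- `∫ κτ^m Y^{1+γ} ≤ ∫ κτ^m E^{1+γ}` on `[t₀, t₁]`
  have hmono : ∫ τ in t₀..t₁, κ * τ ^ m * Y τ ^ (1 + γ) ≤
      ∫ τ in t₀..t₁, κ * τ ^ m * E τ ^ (1 + γ) := by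
    refine intervalIntegral.integral_mono_on_of_le_Ioo ht₀t₁ hiY hiE fun τ hτ => ?_
    have hτ0 : 0 < τ := ht₀pos.trans hτ.1
    exact mul_le_mul_of_nonneg_left
      (Real.rpow_le_rpow (hYpos hτ0).le (habove τ hτ) hγ1)
      (mul_nonneg hκ.le (Real.rpow_nonneg hτ0.le _))
  -- `Y t₁ = Y t₀ − ∫ κτ^m Y^{1+γ}` (fundamental theorem of calculus)
  have hFTC : ∫ τ in t₀..t₁, -κ * τ ^ m * Y τ ^ (1 + γ) = Y t₁ - Y t₀ :=
    intervalIntegral.integral_eq_sub_of_hasDerivAt (fun τ hτ => hYder (hpos_of_mem τ hτ))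
      (by
        have : (fun τ => -κ * τ ^ m * Y τ ^ (1 + γ)) = fun τ => -(κ * τ ^ m * Y τ ^ (1 + γ)) := by
          funext τ; ring
        rw [this]
        exact hiY.neg)
  have hYid : Y t₁ = Y t₀ - ∫ τ in t₀..t₁, κ * τ ^ m * Y τ ^ (1 + γ) := by
    have e : ∫ τ in t₀..t₁, -κ * τ ^ m * Y τ ^ (1 + γ) =
        -∫ τ in t₀..t₁, κ * τ ^ m * Y τ ^ (1 + γ) := by
      rw [← intervalIntegral.integral_neg]
      refine intervalIntegral.integral_congr fun τ _ => ?_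
      ring
    linarith [hFTC, e]
  -- contradiction
  have h1 := hineq t₀ t₁ ht₀pos ht₀t₁ ht₁.2
  linarith [h1, hmono, hYid, hEt₀, hcon']

/-! ### The integrated Bernoulli step WITH the singular linear term:
`F(t) − F(s) = ∫ₛᵗ σ`, `σ ≤ −a τ^m F^{1+γ} + (α/τ) F` -/

/-- **The Nash-iteration step with Gallay–Šverák's singular linear term, integrated form.** Let
`F : [0, T] → ℝ` be continuous, with `F(t) − F(s) = ∫ₛᵗ σ(τ) dτ` for
`0 < s ≤ t ≤ T` (`σ` interval-integrable there) and the slice bound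
`σ(τ) ≤ −a τ^m F(τ)^{1+γ} + (α/τ) F(τ)` for `0 < τ < T` (`a > 0`, `m ≥ 0`, `γ > 0`, `α ≥ 0`, real
powers; no sign condition on `F` is needed). Then
`F(t) ≤ ((m + 1 + αγ)/(aγ))^{1/γ} · t^{−(m+1)/γ}` for `0 < t ≤ T`.
This combines the two printed ODE steps behind Gallay–Šverák's (1.11): their substitution
`f = t^α g` removing the term `(K₂M/t) f` from (5.9) ("we see that (5.9) reduces to the simpler
differential inequality `g'(t) ≤ −K₁M⁻²t^α g(t)²`", arXiv p. 17; `γ = 1`, `m = 0`: the bound is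
`(α+1)/(a t)`, the tree's `le_div_of_deriv_le_neg_mul_sq_add_div_mul`) and Feng–Šverák's
`E' ≤ −κ t^m E^{1+γ}` (the tree's `le_mul_rpow_of_le_sub_intervalIntegral`, `α = 0`), in the
integrated form produced by energy balances with a.e. time derivatives. Proof (no division by `F`,
no substitution): `Y(t) = Λ t^{−(m+1)/γ}`, `Λ^γ = (m+1+αγ)/(aγ)`, solves
`Y' = −a t^m Y^{1+γ} + (α/t) Y` exactly and `Y(0⁺) = +∞`; if `F(t₁) > Y(t₁)`, let `t₀ < t₁` be the
last time with `F(t₀) ≤ Y(t₀)`; on `[t₀, t₁]`, `w = F − Y ≥ 0` satisfies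
`w(t) − w(t₀) ≤ ∫_{t₀}^t (α/τ) w ≤ (α/t₀)(t − t₀) max w`, because `F^{1+γ} ≥ Y^{1+γ}` there; taking
`t − t₀ < t₀/(2α+1)…` so small that `(α/t₀)(t − t₀) ≤ 1/2` and evaluating at the point where `w`
attains its maximum on `[t₀, t]` gives `max w ≤ (max w)/2`, so `w ≤ 0` on `(t₀, t]` — contradicting
the choice of `t₀`. [cite: GallaySverak2016, proof of Prop. 5.3, (5.9) and the substitution f = t^α g (arXiv p. 17); FengSverak2015, proof of Lemma 3.8 (arXiv:1301.6317, p. 12)] -/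
theorem le_mul_rpow_of_sub_eq_integral_of_slice_le {F σ : ℝ → ℝ} {T a m γ α : ℝ} (ha : 0 < a)
    (hm : 0 ≤ m) (hγ : 0 < γ) (hα : 0 ≤ α) (hF : ContinuousOn F (Icc 0 T))
    (hσ : ∀ s t, 0 < s → s ≤ t → t ≤ T → IntervalIntegrable σ volume s t)
    (hbal : ∀ s t, 0 < s → s ≤ t → t ≤ T → F t - F s = ∫ τ in s..t, σ τ)
    (hslice : ∀ τ ∈ Ioo 0 T, σ τ ≤ -a * τ ^ m * F τ ^ (1 + γ) + α / τ * F τ) :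
    ∀ t ∈ Ioc 0 T, F t ≤ ((m + 1 + α * γ) / (a * γ)) ^ (1 / γ) * t ^ (-(m + 1) / γ) := by
  intro t₁ ht₁
  set q : ℝ := -(m + 1) / γ with hq
  set Λ : ℝ := ((m + 1 + α * γ) / (a * γ)) ^ (1 / γ) with hΛ
  have ha0 : a ≠ 0 := ha.ne'
  have hγ0 : γ ≠ 0 := hγ.ne'
  have hm1 : 0 < m + 1 := by linarith
  have hnum : 0 < m + 1 + α * γ := by nlinarith [mul_nonneg hα hγ.le]
  have hbase : 0 < (m + 1 + α * γ) / (a * γ) := div_pos hnum (mul_pos ha hγ)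
  have hΛpos : 0 < Λ := Real.rpow_pos_of_pos hbase _
  have hΛγ : Λ ^ γ = (m + 1 + α * γ) / (a * γ) := by
    rw [hΛ, one_div, Real.rpow_inv_rpow hbase.le hγ.ne']
  have hqγ : q * γ = -(m + 1) := by rw [hq]; field_simp
  have hqneg : q < 0 := by rw [hq]; exact div_neg_of_neg_of_pos (by linarith) hγ
  have hγ1 : (0 : ℝ) ≤ 1 + γ := by linarith
  -- the exact solution `Y = Λ s^q`: `Y' = Λ q s^{q−1} = −a s^m Y^{1+γ} + (α/s) Y` on `(0, ∞)`
  set Y : ℝ → ℝ := fun s => Λ * s ^ q with hY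
  have hYpos : ∀ {s : ℝ}, 0 < s → 0 < Y s := fun hs => mul_pos hΛpos (Real.rpow_pos_of_pos hs _)
  have hYder : ∀ {s : ℝ}, 0 < s → HasDerivAt Y (Λ * (q * s ^ (q - 1))) s := fun {s} hs =>
    (Real.hasDerivAt_rpow_const (p := q) (Or.inl hs.ne')).const_mul Λ
  have hYode : ∀ {s : ℝ}, 0 < s →
      Λ * (q * s ^ (q - 1)) = -a * s ^ m * Y s ^ (1 + γ) + α / s * Y s := by
    intro s hs
    have hs0 : s ≠ 0 := hs.ne'
    have e1 : (Λ * s ^ q) ^ (1 + γ) = Λ * Λ ^ γ * s ^ (q * (1 + γ)) := by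
      rw [Real.mul_rpow hΛpos.le (Real.rpow_nonneg hs.le _), ← Real.rpow_mul hs.le,
        Real.rpow_add hΛpos, Real.rpow_one]
    have e2 : s ^ m * s ^ (q * (1 + γ)) = s ^ (q - 1) := by
      rw [← Real.rpow_add hs]
      congr 1
      linear_combination hqγ
    have e3 : α / s * (Λ * s ^ q) = α * Λ * s ^ (q - 1) := by
      rw [Real.rpow_sub hs, Real.rpow_one]
      field_simp
    show Λ * (q * s ^ (q - 1)) = -a * s ^ m * (Λ * s ^ q) ^ (1 + γ) + α / s * (Λ * s ^ q)
    rw [e1, show -a * s ^ m * (Λ * Λ ^ γ * s ^ (q * (1 + γ))) =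
      -(a * Λ ^ γ) * Λ * (s ^ m * s ^ (q * (1 + γ))) by ring, e2, hΛγ, e3, hq]
    field_simp
    ring
  by_contra hcon
  have hcon' : Y t₁ < F t₁ := by
    have := not_le.1 hcon
    simpa only [hY] using this
  -- `F` is bounded on `[0, T]`; a small `δ ≤ t₁` with `F ≤ Y` at `δ`
  obtain ⟨K, hK⟩ : ∃ K, ∀ s ∈ Icc 0 T, F s ≤ K := by
    obtain ⟨K, hK⟩ := isCompact_Icc.bddAbove_image hF
    exact ⟨K, fun s hs => hK (mem_image_of_mem F hs)⟩
  have hK1 : 0 < max K 1 := lt_max_of_lt_right one_pos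
  set δ₀ : ℝ := (max K 1 / Λ) ^ q⁻¹ with hδ₀
  have hδ₀pos : 0 < δ₀ := Real.rpow_pos_of_pos (div_pos hK1 hΛpos) _
  have hδ₀q : δ₀ ^ q = max K 1 / Λ := by
    rw [hδ₀, Real.rpow_inv_rpow (div_pos hK1 hΛpos).le hqneg.ne]
  set δ : ℝ := min δ₀ t₁ with hδ
  have hδpos : 0 < δ := lt_min hδ₀pos ht₁.1
  have hδt : δ ≤ t₁ := min_le_right _ _
  have hδT : δ ≤ T := hδt.trans ht₁.2
  have hFδ : F δ ≤ Y δ := by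
    have h1 : δ₀ ^ q ≤ δ ^ q := Real.rpow_le_rpow_of_nonpos hδpos (min_le_left _ _) hqneg.le
    rw [hδ₀q, div_le_iff₀ hΛpos] at h1
    calc F δ ≤ K := hK δ ⟨hδpos.le, hδT⟩
      _ ≤ max K 1 := le_max_left _ _
      _ ≤ δ ^ q * Λ := h1
      _ = Y δ := by simp only [hY]; ring
  -- the last time `t₀ ∈ [δ, t₁]` at which `F ≤ Y`
  set A : Set ℝ := Icc δ t₁ ∩ (fun s => F s - Y s) ⁻¹' Iic 0 with hA
  have hYc : ContinuousOn Y (Icc δ t₁) := fun s hs =>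
    (continuousAt_const.mul
      (Real.continuousAt_rpow_const s q (Or.inl (hδpos.trans_le hs.1).ne'))).continuousWithinAt
  have hFc : ContinuousOn F (Icc δ t₁) := hF.mono (Icc_subset_Icc hδpos.le ht₁.2)
  have hAc : IsClosed A := (hFc.sub hYc).preimage_isClosed_of_isClosed isClosed_Icc isClosed_Iic
  have hδA : δ ∈ A := ⟨⟨le_rfl, hδt⟩, show F δ - Y δ ≤ 0 by linarith⟩
  have hAbdd : BddAbove A := ⟨t₁, fun s hs => hs.1.2⟩
  set t₀ : ℝ := sSup A with ht₀
  have ht₀A : t₀ ∈ A := hAc.csSup_mem ⟨δ, hδA⟩ hAbdd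
  have ht₀δ : δ ≤ t₀ := ht₀A.1.1
  have ht₀pos : 0 < t₀ := hδpos.trans_le ht₀δ
  have ht₀t₁ : t₀ ≤ t₁ := ht₀A.1.2
  have hFt₀ : F t₀ ≤ Y t₀ := by
    have h : F t₀ - Y t₀ ≤ 0 := ht₀A.2
    linarith
  have ht₀lt : t₀ < t₁ := by
    rcases ht₀t₁.eq_or_lt with h | h
    · rw [h] at hFt₀; exact absurd hFt₀ (not_le.2 hcon')
    · exact h
  have habove : ∀ τ ∈ Ioc t₀ t₁, Y τ < F τ := by
    intro τ hτ
    by_contra hle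
    have hτA : τ ∈ A := ⟨⟨ht₀δ.trans hτ.1.le, hτ.2⟩, show F τ - Y τ ≤ 0 by
      linarith [not_lt.1 hle]⟩
    exact absurd (le_csSup hAbdd hτA) (not_le.2 hτ.1)
  -- a short time `t ∈ (t₀, t₁]` with `(α/t₀)(t − t₀) ≤ 1/2`
  set κ : ℝ := α / t₀ with hκ
  have hκ0 : 0 ≤ κ := div_nonneg hα ht₀pos.le
  set t : ℝ := min t₁ (t₀ + 1 / (2 * κ + 2)) with htdef
  have h2κ : 0 < 2 * κ + 2 := by linarith
  have htt₀ : t₀ < t := lt_min ht₀lt (by linarith [one_div_pos.2 h2κ])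
  have htt₁ : t ≤ t₁ := min_le_left _ _
  have htT : t ≤ T := htt₁.trans ht₁.2
  have htpos : 0 < t := ht₀pos.trans htt₀
  have hκt : κ * (t - t₀) ≤ 1 / 2 := by
    have h1 : t - t₀ ≤ 1 / (2 * κ + 2) := by linarith [min_le_right t₁ (t₀ + 1 / (2 * κ + 2))]
    calc κ * (t - t₀) ≤ κ * (1 / (2 * κ + 2)) := mul_le_mul_of_nonneg_left h1 hκ0
      _ ≤ 1 / 2 := by
          rw [mul_one_div, div_le_iff₀ h2κ]
          linarith
  -- on `[t₀, t]`: `w = F − Y`, and `w(s) − w(t₀) ≤ ∫_{t₀}^s (α/τ) w ≤ κ (s − t₀) (max w)⁺`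
  have hpos_of_mem : ∀ {s : ℝ}, s ∈ Icc t₀ t → 0 < s := fun hs => ht₀pos.trans_le hs.1
  have hYcI : ContinuousOn Y (Icc t₀ t) := hYc.mono (Icc_subset_Icc ht₀δ htt₁)
  have hFcI : ContinuousOn F (Icc t₀ t) := hF.mono (Icc_subset_Icc ht₀pos.le htT)
  have hwc : ContinuousOn (fun s => F s - Y s) (Icc t₀ t) := hFcI.sub hYcI
  obtain ⟨tm, htm, hmax⟩ := isCompact_Icc.exists_isMaxOn (nonempty_Icc.2 htt₀.le) hwc
  set M : ℝ := F tm - Y tm with hM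
  have hmax' : ∀ s ∈ Icc t₀ t, F s - Y s ≤ M := fun s hs => hmax hs
  -- the integral inequality on `[t₀, s]` for `s ∈ (t₀, t]`
  have hstep : ∀ s ∈ Ioc t₀ t, F s - Y s - (F t₀ - Y t₀) ≤ κ * max M 0 * (s - t₀) := by
    intro s hs
    have hst₀ : t₀ ≤ s := hs.1.le
    have hsT : s ≤ T := hs.2.trans htT
    have hspos : 0 < s := ht₀pos.trans hs.1
    have hmem : ∀ τ ∈ uIcc t₀ s, 0 < τ := fun τ hτ => by
      rw [uIcc_of_le hst₀] at hτ; exact ht₀pos.trans_le hτ.1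
    -- the pieces on `[t₀, s]`
    have hD : ContinuousOn (fun τ : ℝ => Λ * (q * τ ^ (q - 1))) (uIcc t₀ s) := fun τ hτ =>
      (continuousAt_const.mul (continuousAt_const.mul
        (Real.continuousAt_rpow_const τ (q - 1) (Or.inl (hmem τ hτ).ne')))).continuousWithinAt
    have hiD : IntervalIntegrable (fun τ : ℝ => Λ * (q * τ ^ (q - 1))) volume t₀ s :=
      hD.intervalIntegrable
    have hiσ : IntervalIntegrable σ volume t₀ s := hσ t₀ s ht₀pos hst₀ hsT
    have hiR : IntervalIntegrable (fun τ : ℝ => κ * max M 0) volume t₀ s :=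
      intervalIntegrable_const
    -- FTC for `Y`
    have hFTC : ∫ τ in t₀..s, Λ * (q * τ ^ (q - 1)) = Y s - Y t₀ :=
      intervalIntegral.integral_eq_sub_of_hasDerivAt (fun τ hτ => hYder (hmem τ hτ)) hiD
    -- pointwise: `σ − Y' ≤ (α/τ)(F − Y) ≤ κ (max M 0)` on `(t₀, s)`
    have hpt : ∀ τ ∈ Ioo t₀ s, σ τ - Λ * (q * τ ^ (q - 1)) ≤ κ * max M 0 := by
      intro τ hτ
      have hτ0 : 0 < τ := ht₀pos.trans hτ.1
      have hτT : τ < T := lt_of_lt_of_le hτ.2 (hsT)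
      have hτt : τ ∈ Icc t₀ t := ⟨hτ.1.le, hτ.2.le.trans hs.2⟩
      have hYF : Y τ ≤ F τ := (habove τ ⟨hτ.1, hτ.2.le.trans (hs.2.trans htt₁)⟩).le
      have hpow : Y τ ^ (1 + γ) ≤ F τ ^ (1 + γ) :=
        Real.rpow_le_rpow (hYpos hτ0).le hYF hγ1
      have hlin : α / τ * (F τ - Y τ) ≤ κ * max M 0 := by
        have h1 : α / τ ≤ κ := by
          rw [hκ]; exact div_le_div_of_nonneg_left hα ht₀pos hτ.1.le
        have h2 : F τ - Y τ ≤ max M 0 := (hmax' τ hτt).trans (le_max_left _ _)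
        have h3 : 0 ≤ F τ - Y τ := by linarith
        calc α / τ * (F τ - Y τ) ≤ κ * (F τ - Y τ) :=
            mul_le_mul_of_nonneg_right h1 h3
          _ ≤ κ * max M 0 := mul_le_mul_of_nonneg_left h2 hκ0
      rw [hYode hτ0]
      have hsl := hslice τ ⟨hτ0, hτT⟩
      have hneg : -a * τ ^ m * F τ ^ (1 + γ) ≤ -a * τ ^ m * Y τ ^ (1 + γ) := by
        have : 0 ≤ a * τ ^ m := mul_nonneg ha.le (Real.rpow_nonneg hτ0.le _)
        nlinarith
      calc σ τ - (-a * τ ^ m * Y τ ^ (1 + γ) + α / τ * Y τ)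
          ≤ (-a * τ ^ m * F τ ^ (1 + γ) + α / τ * F τ) -
            (-a * τ ^ m * Y τ ^ (1 + γ) + α / τ * Y τ) := by linarith
        _ = (-a * τ ^ m * F τ ^ (1 + γ) - -a * τ ^ m * Y τ ^ (1 + γ)) + α / τ * (F τ - Y τ) := by
            ring
        _ ≤ 0 + κ * max M 0 := add_le_add (by linarith) hlin
        _ = κ * max M 0 := zero_add _
    have hmono : ∫ τ in t₀..s, (σ τ - Λ * (q * τ ^ (q - 1))) ≤ ∫ τ in t₀..s, κ * max M 0 :=
      intervalIntegral.integral_mono_on_of_le_Ioo hst₀ (hiσ.sub hiD) hiR hpt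
    rw [intervalIntegral.integral_sub hiσ hiD, intervalIntegral.integral_const, smul_eq_mul,
      hFTC, ← hbal t₀ s ht₀pos hst₀ hsT] at hmono
    linarith
  -- at the maximiser: `M ≤ (max M 0)/2`, hence `M ≤ 0`
  have hM0 : M ≤ 0 := by
    rcases (show t₀ ≤ tm from htm.1).eq_or_lt with h | h
    · -- maximum attained at `t₀`
      have : M = F t₀ - Y t₀ := by rw [hM, ← h]
      linarith
    · have h1 := hstep tm ⟨h, htm.2⟩
      have h2 : κ * max M 0 * (tm - t₀) ≤ max M 0 * (1 / 2) := by
        have : κ * (tm - t₀) ≤ 1 / 2 :=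
          (mul_le_mul_of_nonneg_left (by linarith [htm.2]) hκ0).trans hκt
        calc κ * max M 0 * (tm - t₀) = max M 0 * (κ * (tm - t₀)) := by ring
          _ ≤ max M 0 * (1 / 2) := mul_le_mul_of_nonneg_left this (le_max_right _ _)
      have h3 : M - (F t₀ - Y t₀) ≤ max M 0 * (1 / 2) := h1.trans h2
      by_contra hMpos
      rw [not_le] at hMpos
      rw [max_eq_left hMpos.le] at h3
      linarith
  -- but `w(t) > 0`
  have hwt : 0 < F t - Y t := by linarith [habove t ⟨htt₀, htt₁⟩]
  have := hmax' t ⟨htt₀.le, le_rfl⟩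
  linarith

end Literature.Analysis.ODE
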